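import Summits.BirchSwinnertonDyer.BirchSwinnertonDyer.Theorems.EdixhovenFibreFiveSevenStarredOptimalManinUnitFiveSevenAssembly
import Summits.BirchSwinnertonDyer.BirchSwinnertonDyer.Theorems.EdixhovenFibreFiveSevenStarredOptimalManinUnitFiveSevenTameTwistLever
import Literature.NumberTheory.PAdicHodge.DualExpOfDeRham
import HarnessLib

/-!
# Manin's conjecture, `p`-part at an ADDITIVE prime `p ≥ 5` with `E[p]` irreducible — the classical statements,
# GRANTED the four cite facts of the F″ programme {P1, (S5b-tower), Kato II Prop. 1.2.3 (surjectivity), de Rham}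

Cell `pub/bsd-wall`, seat `bsd-wall-manin-p1` g9 (explicit-unit; crux of record stmt-BirchSwinnertonDyer-20709
`ManinFrameResidueProperR`; `--supports` 20709, helper). THEOREMS ONLY: three one-line compositions that state, in
CLASSICAL terms and in ONE place, what the landed chain proves about Manin constants — so that a reader (or a
referee of the cite facts) sees the exact mathematical claim without unfolding route declarations:

* `not_dvd_c_latticeOptimal_of_cites` — for `W/ℚ` globally minimal, a prime `p ≥ 5` of ADDITIVE reduction with
  `E[p]` IRREDUCIBLE, and (`p > 7` or `W(ℚ_p)` has no point of order `p`): every LATTICE-OPTIMAL modular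
  parametrisation datum `D` of `W` (`Λ_W = c(D)·Λ_f`) at a level `N` with `p² ∣ N` and `a_ℓ(W) = ±1` at the
  `ℓ ∥ N` has `p ∤ c(D)`;
* `not_dvd_c_conductorOptimal_of_cites` — the same at the CONDUCTOR level `N(W)` for every minimal `W₀ ∼ W` and
  every lattice-optimal datum of `W₀` (`p > 7`; the multiplicative-prime clause is Kraus–Oesterlé, a tree theorem);
* `exists_member_not_dvd_c_of_cites` — `p ≥ 11`: some minimal member of the class carries a conductor-level datum
  with `p ∤ c` (granted modularity `exists_isNewformOf`, which produces the `X₀(N)`-optimal member).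

The four displayed hypotheses are the cite-only Literature facts
P1 = `Kato2004.exists_member_sl2ZetaElement_neron_values` (Kato 2004 (8.1.3)/9.7/6.6(1)/13.6 at Kato's member, Néron
pin), (S5b-tower) = `PAdicHodge.exists_smul_range_expStarCoord_tower_iff_trace_log` (Kato II 1.4.1 + BK90 3.8/3.11),
`PAdicHodge.hasDualExp_of_isDeRham` (Kato II Prop. 1.2.3, surjectivity half; the injectivity half is the tree theorem
`cupLogInjective_of_isDeRham`) and `PAdicHodge.isDeRham_restrictedRationalTateRep` (Fontaine). Chain: F″ :=
`kato_neron_isIntegral_twistedSymbolSum_of_additive_five_le` ⟸ the four facts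
(`KatoAssemblySocket.kato_neron_five_le_of_sl2NeronValues`, edix-p4 g3) and the tame-twist lever
(`KatoLever.stub_tameTwistLever57`, `ManinFrameResidueProperRTameTwist.forall_latticeOptimal_not_dvd_c_of_tameTwistL`,
`…exists_member_not_dvd_c_of_tameTwistL`, seats manin-p1 g3/g4, edix-p1 g0). CONDITIONAL RESULTS (conditional-result);
nothing is closed; BSD is not proved by this. In print the `p`-part of Manin's conjecture at an additive prime is
OPEN beyond Edixhoven 1991 Thm 3 (Česnavičius–Neururer–Saha, JEMS, §1; Pasten 2024 §10.1); the nearest printed use of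
the same lattice bookkeeping is Wuthrich 2014 (Doc. Math. 19) Thm 4 / Prop 8 at SEMISTABLE `p`, and Kim–Nakamura 2020
ASSUME the Manin constant prime to `p` (Assumption 1.1 (3)) — see the seat's memo
`Cruxes/ManinFrameResidueProper/MEMO-kato-manin-novelty-g9.md`.
-/

set_option autoImplicit false
-- the Theorems directory repeats the summit name (D-0017)
set_option linter.dupNamespace false

noncomputable section

open scoped Classical MatrixGroups

open WeierstrassCurve NumberField Literature.NumberTheory.EllipticCurves
  Literature.NumberTheory.EllipticCurves.ModularForms
  Literature.NumberTheory.EllipticCurves.Rank1Residual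
  Literature.NumberTheory.PAdicHodge
  Summit.BirchSwinnertonDyer.BirchSwinnertonDyer.Theorems
  Summit.BirchSwinnertonDyer.BirchSwinnertonDyer.Cruxes.StarredOptimalManinUnitFiveSeven

namespace Summit.BirchSwinnertonDyer.BirchSwinnertonDyer.Theorems.ManinPPartOfKatoCites

/-- F″ from the four cite facts, with Kato II Prop. 1.2.3 demanded only through its surjectivity half
(`hasDualExp_of_isDeRham`; injectivity is the theorem `cupLogInjective_of_isDeRham`).
[cite: Kato2004Asterisque, (8.1.3) (p. 180), Thm. 9.7 (p. 189), Thm. 6.6 (1) (p. 163), Thm. 13.6 (p. 227)]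
[cite: Kato1993LNM1553, Ch. II Prop. 1.2.3 and Thm. 1.4.1 (3)-(4)] [cite: BlochKato1990, Prop. 3.8, Example 3.11] -/
theorem kato_neron_five_le_of_cites
    (hT₂ : exists_smul_range_expStarCoord_tower_iff_trace_log) (hP' : hasDualExp_of_isDeRham)
    (hDR : isDeRham_restrictedRationalTateRep) (hP1 : Kato2004.exists_member_sl2ZetaElement_neron_values) :
    kato_neron_isIntegral_twistedSymbolSum_of_additive_five_le :=
  KatoAssemblySocket.kato_neron_five_le_of_sl2NeronValues hT₂
    (cupLogInjective_and_hasDualExp_of_isDeRham_of_hasDualExp hP') hDR hP1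

/-- **Manin's `p`-part at every lattice-optimal datum, additive `p ≥ 5`, `E[p]` irreducible — GRANTED the four
cites.** For `W/ℚ` globally minimal, `p ≥ 5` a prime of additive reduction (`Addv`) with `E[p]` irreducible
(`Irr`) and (`p > 7` or no `ℚ_p`-rational point of order `p`), `D` a modular parametrisation datum of `W` at a level
`N` with `p² ∣ N`, `a_ℓ(W) = ±1` at every `ℓ ∥ N`, which is LATTICE-OPTIMAL (`Λ_W = c(D)·Λ_f`): `p ∤ c(D)`.
`KatoLever.stub_tameTwistLever57` ∘ `kato_neron_five_le_of_cites`. CONDITIONAL RESULT; nothing is closed.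
[cite: Kato2004Asterisque, (8.1.3) (p. 180), Thm. 9.7 (p. 189)] [cite: KimNakamura2020, Cor. 2.4]
[cite: EdixhovenManin1991, §4 (cases 1/2)] -/
theorem not_dvd_c_latticeOptimal_of_cites
    (hT₂ : exists_smul_range_expStarCoord_tower_iff_trace_log) (hP' : hasDualExp_of_isDeRham)
    (hDR : isDeRham_restrictedRationalTateRep) (hP1 : Kato2004.exists_member_sl2ZetaElement_neron_values)
    (p : ℕ) [Fact p.Prime] (W : WeierstrassCurve ℚ) [W.IsElliptic] [W.IsGloballyMinimal] {N : ℕ} [NeZero N]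
    (D : ModularParametrizationData W N)
    (hopt : ∀ z ∈ D.L.lattice, ∃ w ∈ periodLattice D.f, z = D.c * w) (hp5 : 5 ≤ p)
    (hPT : 7 < p ∨ ∀ P : (W.baseChange ℚ_[p]).toAffine.Point, p • P = 0 → P = 0)
    (hadd : Addv W p) (hirr : Irr W p) (hpN : p ^ 2 ∣ N)
    (ha : ∀ ℓ ∈ N.primeFactors, ¬ ℓ ^ 2 ∣ N → W.LFunction ℓ = 1 ∨ W.LFunction ℓ = -1) :
    ¬ (p : ℤ) ∣ D.c :=
  KatoLever.stub_tameTwistLever57 (kato_neron_five_le_of_cites hT₂ hP' hDR hP1) p W D hopt hp5 hPT hadd hirr hpN ha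

/-- **Manin's `p`-part at the conductor level, additive `p > 7`, `E[p]` irreducible — GRANTED the four cites.**
For `W/ℚ` globally minimal, additive at a prime `p > 7` with `E[p]` irreducible: EVERY lattice-optimal datum at
the conductor level `N(W)` of EVERY globally minimal `W₀` isogenous to `W` has `p ∤ c` (the multiplicative-prime
clause `a_ℓ = ±1` is Kraus–Oesterlé, `p² ∣ N(W)` is `Addv`; both tree theorems inside
`ManinFrameResidueProperRTameTwist.forall_latticeOptimal_not_dvd_c_of_tameTwistL`). CONDITIONAL RESULT.
[cite: Kato2004Asterisque, (8.1.3) (p. 180), Thm. 9.7 (p. 189)] [cite: KimNakamura2020, Cor. 2.4]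
[cite: KrausOesterle1992, (the criterion: a_ℓ = ±1 at multiplicative ℓ)] -/
theorem not_dvd_c_conductorOptimal_of_cites
    (hT₂ : exists_smul_range_expStarCoord_tower_iff_trace_log) (hP' : hasDualExp_of_isDeRham)
    (hDR : isDeRham_restrictedRationalTateRep) (hP1 : Kato2004.exists_member_sl2ZetaElement_neron_values)
    {p : ℕ} [Fact p.Prime] (W : WeierstrassCurve ℚ) [W.IsElliptic] [W.IsGloballyMinimal]
    [NeZero (W.conductorNorm ℤ)] (hp7 : 7 < p) (hadd : Addv W p) (hirr : Irr W p)
    (W₀ : WeierstrassCurve ℚ) [W₀.IsElliptic] [W₀.IsGloballyMinimal] (hiso : IsIsogenous W W₀)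
    (D₀ : ModularParametrizationData W₀ (W.conductorNorm ℤ))
    (hopt : ∀ z ∈ D₀.L.lattice, ∃ w ∈ periodLattice D₀.f, z = D₀.c * w) :
    ¬ (p : ℤ) ∣ D₀.c :=
  ManinFrameResidueProperRTameTwist.forall_latticeOptimal_not_dvd_c_of_tameTwistL
    (KatoLever.kato_neron_of_five_le (kato_neron_five_le_of_cites hT₂ hP' hDR hP1)) W hp7 hadd hirr W₀ hiso D₀ hopt

/-- **A Manin-unit member at every additive irreducible frame, `p ≥ 11` — GRANTED the four cites and
modularity.** For `W/ℚ` globally minimal, additive at `p ≥ 11` with `E[p]` irreducible: some globally minimal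
`W₀ ∼ W` carries a modular parametrisation datum at level `N(W)` with `p ∤ c` (the `X₀(N)`-optimal member, via
`exists_isNewformOf`). By Edixhoven 1991 Thm 3 the content is on the potentially ordinary Kodaira II/III/IV locus;
that theorem is NOT used. CONDITIONAL RESULT. [cite: Kato2004Asterisque, (8.1.3) (p. 180), Thm. 9.7 (p. 189)]
[cite: EdixhovenManin1991, Thm. 3 and §4] -/
theorem exists_member_not_dvd_c_of_cites
    (hT₂ : exists_smul_range_expStarCoord_tower_iff_trace_log) (hP' : hasDualExp_of_isDeRham)
    (hDR : isDeRham_restrictedRationalTateRep) (hP1 : Kato2004.exists_member_sl2ZetaElement_neron_values)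
    (hnf : exists_isNewformOf)
    {p : ℕ} [Fact p.Prime] (W : WeierstrassCurve ℚ) [W.IsElliptic] [W.IsGloballyMinimal]
    [NeZero (W.conductorNorm ℤ)] (hp11 : 11 ≤ p) (hadd : Addv W p) (hirr : Irr W p) :
    ∃ (W₀ : WeierstrassCurve ℚ) (_ : W₀.IsElliptic) (_ : W₀.IsGloballyMinimal)
      (D₀ : ModularParametrizationData W₀ (W.conductorNorm ℤ)),
      IsIsogenous W W₀ ∧ ¬ (p : ℤ) ∣ D₀.c :=
  ManinFrameResidueProperRTameTwist.exists_member_not_dvd_c_of_tameTwistL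
    (KatoLever.kato_neron_of_five_le (kato_neron_five_le_of_cites hT₂ hP' hDR hP1)) hnf W hp11 hadd hirr

end Summit.BirchSwinnertonDyer.BirchSwinnertonDyer.Theorems.ManinPPartOfKatoCites

end
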